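import Literature.Computability.Complexity.SpaceTMSATHard
import Literature.Computability.Complexity.CfgCodesRead
import HarnessLib

/-!
# The halting time of a space-bounded decider: short codes of configurations and the pigeonhole

Machine-level form of Arora–Barak 2009, Claim 4.4(1) and the proof of Thm. 4.2
(`SPACE(S(n)) ⊆ DTIME(2^{O(S(n))})`, PDF pp. 106–108): *a configuration of a space-`S` machine on
an input `x` of length `n` is described by `O(S(n) + log n)` bits — the contents of the work tapes,
the position of the input head and the state — so there are few configurations, and a halting
deterministic run, which never repeats a configuration, is that short.* For the tree's space
machines (`SpaceMachine`, `DecidesInSpace`, `Space.lean`: Mathlib's multi-stack machines with a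
two-stack read-only input `kL`/`k₀`) this file proves:

* `SpaceMachine.shortCode M c` — the **short code** of a configuration `c`: label, state, the
  length of the left input stack `kL` (the head position) and the symbol numbers of the WORK stacks
  (`TM2Std.enc`, `UnivStep.encStacks`), as one `boolPair` record; the input itself is not coded;
* `SpaceMachine.eq_of_shortCode_eq` — on configurations whose input stacks spell the same input
  `x` (`IsInputPreserving`) and whose symbols are allowed (`TM2Std.StkOK`) the short code is
  injective (the head position determines both input stacks);
* `SpaceMachine.length_shortCode_le` — `|shortCode c| ≤ A₀ · workSpace c + 2 |bin |x|| + K₀`;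
* `SpaceMachine.haltTime hM x`, `haltCfg hM x` — the first halting time of the total run
  (`TM2Sim.stepTotal`) of a decider on `x` and its halting configuration (fixed from then on,
  output stack `[x ∈ L]`), and **`SpaceMachine.haltTime_lt`**: `haltTime < (B + 1) · 2^B` for
  `B = A₀ · S x + 2 |bin |x|| + K₀` (the configurations before the halt are pairwise distinct and
  reachable, hence input preserving, in space `S x`, with short codes of length `≤ B`;
  `SpaceTMSAT.card_le_of_injective_short`);
* `SpaceMachine.exists_poly_haltTime` — for `S x ≤ c · log₂|x| + c` the bound is a polynomial in
  `|x|` (`2^{O(log n)} = n^{O(1)}`): the time bound behind `LOGSPACE ⊆ P`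
  (`TimeSpaceProofs.lean`).

## References

* S. Arora, B. Barak, *Computational Complexity: A Modern Approach*, CUP 2009 [AroraBarak2009]
  (held: `book:arora2009-computational-complexity-modern-approach`): Thm. 4.2 (PDF p. 106),
  Claim 4.4(1) and its proof sketch (PDF p. 107), proof of Thm. 4.2 (PDF p. 108), Def. 4.5.
* M. Sipser, *Introduction to the Theory of Computation*, 3rd ed., 2012, Lemma 5.8 / proof of
  Thm. 8.5 (a machine in space `f(n)` has at most `2^{O(f(n))} · n` configurations) [Sipser2012].
-/

noncomputable section

namespace Literature.Computability.Complexity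

namespace SpaceMachine

open Turing TM2Std TM2Sim StateTransition Function _root_.Computability
open UnivStep (bin encStacks)
open SpaceTMSAT (boolPair_inj bin_injective encStacks_injective length_bin_mono
  length_encStacks_le enc_eq_enc_iff_of_allowed finTM2_step_eq_none_iff card_le_of_injective_short)

variable (M : SpaceMachine Bool Bool)

/-! ### Short codes of configurations -/

/-- The work stacks of the machine (all stacks but the two input stacks `k₀`, `kL`), as a list.
[cite: AroraBarak2009, Def. 4.1 (work tapes)] -/
def workList : List M.tm.K :=
  haveI := M.tm.kFin
  ((Finset.univ.erase M.tm.k₀).erase M.kL).toList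

/-- Membership in `workList`. [folklore] -/
theorem mem_workList {k : M.tm.K} : k ∈ M.workList ↔ k ≠ M.tm.k₀ ∧ k ≠ M.kL := by
  letI := M.tm.kFin
  unfold workList
  rw [Finset.mem_toList, Finset.mem_erase, Finset.mem_erase]
  simp only [Finset.mem_univ, and_true]
  tauto

/-- The symbol numbers (`TM2Std.enc`) of the work stacks, stack by stack along `workList`.
[cite: AroraBarak2009, Claim 4.4 (proof sketch: "the contents of all work tapes")] -/
def workCodes (S : ∀ k, List (M.tm.Γ k)) : List (List ℕ) :=
  M.workList.map fun k => (S k).map fun γ => (TM2Std.enc M.tm ⟨k, γ⟩).val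

/-- There is one coded stack per work stack. [folklore] -/
theorem length_workCodes (S : ∀ k, List (M.tm.Γ k)) : (M.workCodes S).length = M.workList.length := by
  simp [workCodes]

/-- The coded work stacks hold `workSpace` symbols in total. [cite: AroraBarak2009, Def. 4.1] -/
theorem stkTotal_workCodes (c : M.tm.Cfg) : FlatProg.stkTotal (M.workCodes c.stk) = M.workSpace c := by
  letI := M.tm.kFin
  have h : ∀ k : M.tm.K, ((c.stk k).map fun γ => (TM2Std.enc M.tm ⟨k, γ⟩).val).length = (c.stk k).length :=
    fun k => List.length_map _
  unfold FlatProg.stkTotal workCodes workSpace workList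
  rw [List.map_map]
  simp only [Function.comp_def, h]
  exact Finset.sum_map_toList _ _

/-- The symbol numbers are at most `N = stdN`. [folklore] -/
theorem workCodes_le (S : ∀ k, List (M.tm.Γ k)) : ∀ s ∈ M.workCodes S, ∀ a ∈ s, a ≤ stdN M.tm := by
  intro s hs a ha
  simp only [workCodes, List.mem_map] at hs
  obtain ⟨k, -, rfl⟩ := hs
  rw [List.mem_map] at ha
  obtain ⟨γ, -, rfl⟩ := ha
  exact Nat.le_of_lt_succ (Fin.isLt _)

/-- Symbol numbers determine allowed symbols, stackwise. [folklore] -/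
theorem eq_of_map_enc_eq {k : M.tm.K} : ∀ {L₁ L₂ : List (M.tm.Γ k)},
    (∀ γ ∈ L₁, (⟨k, γ⟩ : Σ k, M.tm.Γ k) ∈ allowed M.tm) →
    L₁.map (fun γ => (TM2Std.enc M.tm ⟨k, γ⟩).val) = L₂.map (fun γ => (TM2Std.enc M.tm ⟨k, γ⟩).val) → L₁ = L₂
  | [], [], _, _ => rfl
  | [], _ :: _, _, h => by simp at h
  | _ :: _, [], _, h => by simp at h
  | γ₁ :: L₁, γ₂ :: L₂, hok, h => by
    simp only [List.map_cons, List.cons.injEq] at h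
    have h1 : TM2Std.enc M.tm ⟨k, γ₁⟩ = TM2Std.enc M.tm ⟨k, γ₂⟩ := Fin.ext h.1
    rw [enc_eq_enc_iff_of_allowed (hok γ₁ (by simp))] at h1
    have h2 : γ₁ = γ₂ := eq_of_heq (Sigma.mk.inj h1).2
    subst h2
    rw [eq_of_map_enc_eq (fun γ hγ => hok γ (by simp [hγ])) h.2]

/-- Equal work codes give equal work stacks (allowed symbols). [folklore] -/
theorem stk_eq_of_workCodes_eq {S₁ S₂ : ∀ k, List (M.tm.Γ k)} (h₁ : StkOK M.tm S₁)
    (h : M.workCodes S₁ = M.workCodes S₂) {k : M.tm.K} (hk₀ : k ≠ M.tm.k₀) (hkL : k ≠ M.kL) :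
    S₁ k = S₂ k := by
  have hk : k ∈ M.workList := (M.mem_workList).2 ⟨hk₀, hkL⟩
  unfold workCodes at h
  rw [List.map_inj_left] at h
  exact M.eq_of_map_enc_eq (h₁ k) (h k hk)

/-- The number of a label (`0` for "halted", otherwise `1 +` its index along `eΛ`). [folklore] -/
def lblCode (l : Option M.tm.Λ) : ℕ := l.elim 0 fun q => (eΛ M.tm q).val + 1

/-- `lblCode` is injective. [folklore] -/
theorem lblCode_injective : Injective M.lblCode := by
  intro l₁ l₂ h
  cases l₁ with
  | none =>
    cases l₂ with
    | none => rfl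
    | some q => simp [lblCode] at h
  | some q =>
    cases l₂ with
    | none => simp [lblCode] at h
    | some q' =>
      simp only [lblCode, Option.elim_some, Nat.add_right_cancel_iff] at h
      rw [(eΛ M.tm).injective (Fin.ext h)]

/-- `lblCode l ≤ nΛ`. [folklore] -/
theorem lblCode_le (l : Option M.tm.Λ) : M.lblCode l ≤ nΛ M.tm := by
  cases l with
  | none => exact Nat.zero_le _
  | some q => exact (eΛ M.tm q).isLt

/-- **The short code of a configuration**: `⟨label, ⟨state, ⟨|stack kL|, work stacks⟩⟩⟩` with
numbers in binary — the state, the position of the input head and the contents of the work tapes,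
but NOT the input (Arora–Barak's description of a vertex of the configuration graph `G_{M,x}`).
[cite: AroraBarak2009, Claim 4.4(1) (proof sketch)] -/
def shortCode (c : M.tm.Cfg) : List Bool :=
  boolPair (bin (M.lblCode c.l)) (boolPair (bin (eσ M.tm c.var).val)
    (boolPair (bin (c.stk M.kL).length) (encStacks (M.workCodes c.stk))))

/-- Configurations are determined by their three fields. [Mathlib `Turing.TM2.Cfg`] [folklore] -/
theorem cfg_ext {a b : M.tm.Cfg} (hl : a.l = b.l) (hv : a.var = b.var) (hs : a.stk = b.stk) : a = b := by
  obtain ⟨la, va, Sa⟩ := a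
  obtain ⟨lb, vb, Sb⟩ := b
  simp only at hl hv hs
  subst hl hv hs
  rfl

/-- **The short code is injective on the configuration graph of `x`**: two configurations whose
input stacks spell the same input `x` (the invariant of `IsInputPreserving`), the first with
allowed symbols, and with the same short code, are equal — the head position `|stack kL|`
determines both halves of the read-only input. [cite: AroraBarak2009, Claim 4.4(1)] -/
theorem eq_of_shortCode_eq {a b : M.tm.Cfg} {x : List Bool} (hok : StkOK M.tm a.stk)
    (ha : ((a.stk M.kL).map M.leftAlphabet).reverse ++ (a.stk M.tm.k₀).map M.inputAlphabet = x)
    (hb : ((b.stk M.kL).map M.leftAlphabet).reverse ++ (b.stk M.tm.k₀).map M.inputAlphabet = x)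
    (h : M.shortCode a = M.shortCode b) : a = b := by
  obtain ⟨h1, h⟩ := boolPair_inj h
  obtain ⟨h2, h⟩ := boolPair_inj h
  obtain ⟨h3, h4⟩ := boolPair_inj h
  have hl : a.l = b.l := M.lblCode_injective (bin_injective h1)
  have hv : a.var = b.var := (eσ M.tm).injective (Fin.ext (bin_injective h2))
  have hp : (a.stk M.kL).length = (b.stk M.kL).length := bin_injective h3
  have hW : M.workCodes a.stk = M.workCodes b.stk := encStacks_injective h4
  obtain ⟨e1, e2⟩ := List.append_inj (ha.trans hb.symm) (by simpa using hp)
  have hkL : a.stk M.kL = b.stk M.kL :=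
    (List.map_injective_iff.2 M.leftAlphabet.injective) (List.reverse_injective e1)
  have hk₀ : a.stk M.tm.k₀ = b.stk M.tm.k₀ := (List.map_injective_iff.2 M.inputAlphabet.injective) e2
  refine M.cfg_ext hl hv (funext fun k => ?_)
  by_cases h₀ : k = M.tm.k₀
  · subst h₀; exact hk₀
  by_cases hL : k = M.kL
  · subst hL; exact hkL
  exact M.stk_eq_of_workCodes_eq hok hW h₀ hL

/-- The cost of one work symbol in a short code: `2 (2 |bin N| + 2)`. [folklore] -/
def A₀ : ℕ := 2 * (2 * (bin (stdN M.tm)).length + 2)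

/-- The constant part of a short code: label, state, separators. [folklore] -/
def K₀ : ℕ := 2 * (bin (nΛ M.tm)).length + 2 * (bin (nσ M.tm)).length + 2 * M.workList.length + 6

/-- **Short codes are short**: `|shortCode c| ≤ A₀ · s + 2 |bin |x|| + K₀` for a configuration on
the input `x` (input stacks spelling `x`) with work space `≤ s` — Arora–Barak's `c S(n)` bits, with
the `log n` of the head position made explicit. [cite: AroraBarak2009, Claim 4.4(1)] -/
theorem length_shortCode_le {c : M.tm.Cfg} {x : List Bool} {s : ℕ}
    (hIP : ((c.stk M.kL).map M.leftAlphabet).reverse ++ (c.stk M.tm.k₀).map M.inputAlphabet = x)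
    (hws : M.workSpace c ≤ s) :
    (M.shortCode c).length ≤ M.A₀ * s + 2 * (bin x.length).length + M.K₀ := by
  have hp : (c.stk M.kL).length ≤ x.length := by
    have e := congrArg List.length hIP
    simp only [List.length_append, List.length_reverse, List.length_map] at e
    omega
  have h1 := length_bin_mono (M.lblCode_le c.l)
  have h2 := length_bin_mono (n := (eσ M.tm c.var).val) (N := nσ M.tm) (Fin.isLt _).le
  have h3 := length_bin_mono hp
  have h4 := length_encStacks_le (M.workCodes c.stk) (M.workCodes_le c.stk)
  rw [stkTotal_workCodes, length_workCodes] at h4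
  have h5 : 2 * (2 * (bin (stdN M.tm)).length + 2) * M.workSpace c ≤ M.A₀ * s :=
    Nat.mul_le_mul_left _ hws
  simp only [shortCode, length_boolPair]
  unfold K₀
  omega

/-! ### The total run of a decider: first halting time and halting configuration -/

variable {M}
variable {L : Language Bool} {S : List Bool → ℕ}

/-- A decider halts: some iterate of the total step function from the initial configuration on
`x` has no label. [cite: AroraBarak2009, Def. 4.1] -/
theorem exists_l_eq_none (hM : DecidesInSpace M L S) (x : List Bool) :
    ∃ n, ((stepTotal M.tm)^[n] (M.init x)).l = none := by
  obtain ⟨cf, hev, -⟩ := (hM.2 x).1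
  obtain ⟨hreach, hnone⟩ := mem_eval.1 hev
  obtain ⟨n, hn⟩ := SpaceLoop.exists_iterate_of_reaches hreach
  exact ⟨n, by rw [iterate_stepTotal_of_bind M.tm hn]; exact (finTM2_step_eq_none_iff M.tm cf).1 hnone⟩

open scoped Classical in
/-- **The halting time** of the decider on `x`: the first `n` at which the total run is halted.
[cite: AroraBarak2009, Thm. 4.2 (proof)] -/
def haltTime (hM : DecidesInSpace M L S) (x : List Bool) : ℕ := Nat.find (exists_l_eq_none hM x)

/-- **The halting configuration** of the decider on `x`. [cite: AroraBarak2009, Thm. 4.2 (proof)] -/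
def haltCfg (hM : DecidesInSpace M L S) (x : List Bool) : M.tm.Cfg :=
  (stepTotal M.tm)^[haltTime hM x] (M.init x)

/-- The halting configuration is halted. [folklore] -/
theorem haltCfg_l (hM : DecidesInSpace M L S) (x : List Bool) : (haltCfg hM x).l = none := by
  classical
  exact Nat.find_spec (exists_l_eq_none hM x)

/-- Before the halting time the run is running. [folklore] -/
theorem l_ne_none_of_lt (hM : DecidesInSpace M L S) (x : List Bool) {i : ℕ} (hi : i < haltTime hM x) :
    ((stepTotal M.tm)^[i] (M.init x)).l ≠ none := by
  classical
  exact Nat.find_min (exists_l_eq_none hM x) hi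

/-- From the halting time on the run is frozen at the halting configuration. [folklore] -/
theorem iterate_eq_haltCfg (hM : DecidesInSpace M L S) (x : List Bool) {t : ℕ} (ht : haltTime hM x ≤ t) :
    (stepTotal M.tm)^[t] (M.init x) = haltCfg hM x := by
  obtain ⟨d, rfl⟩ := Nat.exists_eq_add_of_le ht
  rw [Nat.add_comm, iterate_add_apply]
  exact iterate_stepTotal_of_none M.tm (haltCfg_l hM x) d

/-- A total run that is running before time `m` is a run of Mathlib's partial step function:
configuration `m` is reachable. [folklore] -/
theorem reaches_iterate_stepTotal (tm : FinTM2) (a : tm.Cfg) :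
    ∀ m : ℕ, (∀ i < m, ((stepTotal tm)^[i] a).l ≠ none) → Reaches tm.step a ((stepTotal tm)^[m] a)
  | 0, _ => Relation.ReflTransGen.refl
  | m + 1, h => by
    have ih := reaches_iterate_stepTotal tm a m fun i hi => h i (Nat.lt_succ_of_lt hi)
    obtain ⟨l, hl⟩ := Option.ne_none_iff_exists'.1 (h m (Nat.lt_succ_self m))
    rw [iterate_succ_apply']
    exact ih.tail (step_eq_of_some tm hl)

/-- The configurations up to the halting time are reachable. [folklore] -/
theorem reaches_iterate (hM : DecidesInSpace M L S) (x : List Bool) {i : ℕ} (hi : i ≤ haltTime hM x) :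
    Reaches M.tm.step (M.init x) ((stepTotal M.tm)^[i] (M.init x)) :=
  reaches_iterate_stepTotal M.tm (M.init x) i fun _ hj => l_ne_none_of_lt hM x (lt_of_lt_of_le hj hi)

/-- All configurations of the total run have allowed symbols. [folklore] -/
theorem stkOK_iterate (M : SpaceMachine Bool Bool) (x : List Bool) (i : ℕ) :
    StkOK M.tm ((stepTotal M.tm)^[i] (M.init x)).stk :=
  stkOK_iterate_stepTotal M.tm (stkOK_initList M.tm _) i

/-- **The halting configuration outputs the answer**: its output stack reads `[x ∈ L]`.
[cite: AroraBarak2009, Def. 4.1] -/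
theorem haltCfg_output (hM : DecidesInSpace M L S) (x : List Bool) :
    ((haltCfg hM x).stk M.tm.k₁).map M.outputAlphabet = encodeBool (L.boolIndicator x) := by
  classical
  obtain ⟨cf, hev, hout⟩ := (hM.2 x).1
  obtain ⟨hreach, hnone⟩ := mem_eval.1 hev
  obtain ⟨n, hn⟩ := SpaceLoop.exists_iterate_of_reaches hreach
  have hcf : (stepTotal M.tm)^[n] (M.init x) = cf := iterate_stepTotal_of_bind M.tm hn
  have hle : haltTime hM x ≤ n :=
    Nat.find_min' (exists_l_eq_none hM x) (by rw [hcf]; exact (finTM2_step_eq_none_iff M.tm cf).1 hnone)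
  rw [← iterate_eq_haltCfg hM x hle, hcf]
  exact hout

/-- **A halting run never repeats a configuration**: the configurations at times `i < j ≤ haltTime`
differ (otherwise the run would be halted already at time `i + (haltTime - j) < haltTime`).
[cite: AroraBarak2009, Thm. 4.2 (proof)] -/
theorem iterate_ne_of_lt (hM : DecidesInSpace M L S) (x : List Bool) {i j : ℕ} (hij : i < j)
    (hj : j ≤ haltTime hM x) :
    (stepTotal M.tm)^[i] (M.init x) ≠ (stepTotal M.tm)^[j] (M.init x) := by
  intro h
  have e : (stepTotal M.tm)^[i + (haltTime hM x - j)] (M.init x) = haltCfg hM x := by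
    rw [Nat.add_comm, iterate_add_apply, h, ← iterate_add_apply, Nat.sub_add_cancel hj]
    rfl
  exact l_ne_none_of_lt hM x (i := i + (haltTime hM x - j)) (by omega) (by rw [e]; exact haltCfg_l hM x)

/-! ### The pigeonhole: the halting time is at most the number of short codes -/

/-- **The halting time of a space-`S` decider**: `haltTime < (B + 1) · 2^B` with
`B = A₀ · S x + 2 |bin |x|| + K₀` — the configurations before the halt are pairwise distinct,
reachable (hence input preserving and in work space `S x`) and so have pairwise distinct short
codes of length `≤ B`. [cite: AroraBarak2009, Thm. 4.2 (proof) and Claim 4.4(1)] -/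
theorem haltTime_lt (hM : DecidesInSpace M L S) (x : List Bool) :
    haltTime hM x < (M.A₀ * S x + 2 * (bin x.length).length + M.K₀ + 1) *
      2 ^ (M.A₀ * S x + 2 * (bin x.length).length + M.K₀) := by
  refine Nat.lt_of_succ_le (card_le_of_injective_short
    (fun m => M.shortCode ((stepTotal M.tm)^[m] (M.init x))) (fun m hm => ?_) (fun m₁ hm₁ m₂ hm₂ heq => ?_))
  · have hr := reaches_iterate hM x (Nat.le_of_lt_succ hm)
    exact M.length_shortCode_le (hM.1 x _ hr) ((hM.2 x).2 _ hr)
  · have h₁ := reaches_iterate hM x (Nat.le_of_lt_succ hm₁)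
    have h₂ := reaches_iterate hM x (Nat.le_of_lt_succ hm₂)
    have heq' := M.eq_of_shortCode_eq (stkOK_iterate M x m₁) (hM.1 x _ h₁) (hM.1 x _ h₂) heq
    by_contra hne
    rcases Nat.lt_or_gt_of_ne hne with hlt | hlt
    · exact iterate_ne_of_lt hM x hlt (Nat.le_of_lt_succ hm₂) heq'
    · exact iterate_ne_of_lt hM x hlt (Nat.le_of_lt_succ hm₁) heq'.symm

/-! ### Logarithmic space: a polynomial halting time -/

/-- `2^{|bin n|} ≤ 2 n + 1` (`|bin n| = size n`). [folklore] -/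
theorem two_pow_length_bin_le (n : ℕ) : 2 ^ (bin n).length ≤ 2 * n + 1 := by
  rw [UnivStep.bin, TM2Pass.length_encodeNat_eq_size]
  rcases Nat.eq_zero_or_pos n with rfl | hn
  · simp
  · have h1 : n.size ≤ Nat.log 2 n + 1 := Nat.size_le.2 (Nat.lt_pow_succ_log_self (by norm_num) n)
    have h2 : 2 ^ Nat.log 2 n ≤ n := Nat.pow_log_le_self 2 hn.ne'
    calc 2 ^ n.size ≤ 2 ^ (Nat.log 2 n + 1) := Nat.pow_le_pow_right (by norm_num) h1
      _ = 2 * 2 ^ Nat.log 2 n := by rw [pow_succ, Nat.mul_comm]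
      _ ≤ 2 * n + 1 := by omega

/-- `|bin n| ≤ log₂ n + 1`. [folklore] -/
theorem length_bin_le_log (n : ℕ) : (bin n).length ≤ Nat.log 2 n + 1 := by
  rw [UnivStep.bin, TM2Pass.length_encodeNat_eq_size]
  rcases Nat.eq_zero_or_pos n with rfl | hn
  · simp
  · exact Nat.size_le.2 (Nat.lt_pow_succ_log_self (by norm_num) n)

/-- `2^{log₂ n} ≤ n + 1`. [folklore] -/
theorem two_pow_log_le_succ (n : ℕ) : 2 ^ Nat.log 2 n ≤ n + 1 := by
  rcases Nat.eq_zero_or_pos n with rfl | hn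
  · simp
  · exact (Nat.pow_log_le_self 2 hn.ne').trans (Nat.le_succ n)

/-- **Logarithmic space gives a polynomial halting time.** If `M` decides `L` in work space
`S x ≤ c · log₂|x| + c`, there is a polynomial `T` with `T(n) ≥ n` such that on every input `x` the
run has halted before time `T(|x|)`: with `ℓ = log₂|x|`, `B ≤ α ℓ + β` for `α = A₀ c + 2`,
`β = A₀ c + K₀ + 2`, and `(B + 1) 2^B ≤ (α|x| + β + 1) · 2^β · (|x| + 1)^α` (`2^ℓ ≤ |x| + 1`).
This is `2^{O(log n)} = n^{O(1)}` configurations, the count behind `L ⊆ P`.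
[cite: AroraBarak2009, Thm. 4.2 and Claim 4.4(1); Def. 4.5 (L = SPACE(log n))] -/
theorem exists_poly_haltTime (hM : DecidesInSpace M L S) {c : ℕ}
    (hS : ∀ x, S x ≤ c * Nat.log 2 x.length + c) :
    ∃ T : Polynomial ℕ, (∀ n, n ≤ T.eval n) ∧ ∀ x, haltTime hM x < T.eval x.length := by
  set α : ℕ := M.A₀ * c + 2 with hα
  set β : ℕ := M.A₀ * c + M.K₀ + 2 with hβ
  refine ⟨Polynomial.X + (Polynomial.C α * Polynomial.X + Polynomial.C (β + 1)) *
    Polynomial.C (2 ^ β) * (Polynomial.X + 1) ^ α, fun n => ?_, fun x => ?_⟩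
  · simp only [Polynomial.eval_add, Polynomial.eval_mul, Polynomial.eval_X, Polynomial.eval_C,
      Polynomial.eval_pow, Polynomial.eval_one]
    exact Nat.le_add_right _ _
  · simp only [Polynomial.eval_add, Polynomial.eval_mul, Polynomial.eval_X, Polynomial.eval_C,
      Polynomial.eval_pow, Polynomial.eval_one]
    set n := x.length with hn
    set ℓ := Nat.log 2 n with hℓ
    set B := M.A₀ * S x + 2 * (bin n).length + M.K₀ with hB
    have hBle : B ≤ α * ℓ + β := by
      have h1 : M.A₀ * S x ≤ M.A₀ * (c * ℓ + c) := Nat.mul_le_mul_left _ (hS x)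
      have h2 := length_bin_le_log n
      rw [hB, hα, hβ]
      rw [← hℓ] at h2
      nlinarith
    have hlt := haltTime_lt hM x
    rw [← hn, ← hB] at hlt
    have hℓn : ℓ ≤ n := Nat.log_le_self 2 n
    have h2ℓ : 2 ^ ℓ ≤ n + 1 := two_pow_log_le_succ n
    have hpow : 2 ^ B ≤ 2 ^ β * (n + 1) ^ α := by
      calc 2 ^ B ≤ 2 ^ (α * ℓ + β) := Nat.pow_le_pow_right (by norm_num) hBle
        _ = 2 ^ β * (2 ^ ℓ) ^ α := by rw [pow_add, pow_mul', Nat.mul_comm]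
        _ ≤ 2 ^ β * (n + 1) ^ α := Nat.mul_le_mul_left _ (Nat.pow_le_pow_left h2ℓ α)
    have hlin : B + 1 ≤ α * n + (β + 1) := by nlinarith
    calc haltTime hM x < (B + 1) * 2 ^ B := hlt
      _ ≤ (α * n + (β + 1)) * (2 ^ β * (n + 1) ^ α) := Nat.mul_le_mul hlin hpow
      _ = (α * n + (β + 1)) * 2 ^ β * (n + 1) ^ α := by rw [Nat.mul_assoc]
      _ ≤ n + (α * n + (β + 1)) * 2 ^ β * (n + 1) ^ α := Nat.le_add_left _ _

end SpaceMachine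

end Literature.Computability.Complexity

end
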